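import Summits.KontsevichZagierPeriods.KontsevichZagierPeriods.Theses.Grothendieck
import Summits.KontsevichZagierPeriods.KontsevichZagierPeriods.Theorems.MzvKernelInKZ.Negative.WeightFour
import Summits.KontsevichZagierPeriods.KontsevichZagierPeriods.Theorems.MzvKernelInKZ.Negative.ShuffleFour
import Summits.KontsevichZagierPeriods.KontsevichZagierPeriods.Theorems.StuffleInKZ.Negative.Core

/-!
# `GpcZeta4Eq4zeta31` (route `Grothendieck`, stmt-KontsevichZagierPeriods-0275): negative-side core —
# read-back, collapse to one typed membership, eval-tightness, summit-necessity, neighbours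

Negative-side support for the crux `GpcZeta4Eq4zeta31` (cdisprove unit, refuter
`refuter-cdisprove-stmt-KontsevichZagierPeriods-0275-0`, 2026-08-16; running commentary in the work
file `Cruxes/GpcZeta4Eq4zeta31/Disproof.lean`). The crux asserts that the two 4-dimensional simplex
representations `[Δ₄, ω₀ω₀ω₀ω₁]` (`ζ(4)`) and `[Δ₄, 4·ω₀ω₀ω₁ω₁]` (`4ζ(3,1)`) are `KZ.Equivalent`, in the
`∀ r r'` packaging (domain and integrands pinned only on the domain). Nothing here refutes it. This file
records, as theorems the other seats of the crux can import:

* §0 read-back: the crux is literally FurushoPentagon's `Zeta4Calibration`; the inlined simplex is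
  `MzvKernelInKZ.Negative.simplex 4`; the inlined integrands are `wordFun ω4 1`, `wordFun ω31 4`
  everywhere (no convention slip);
* §1 COLLAPSE: `crux_iff_target : GpcZeta4Eq4zeta31 ↔ cFds4 ∈ KZ.relations` (the typed weight-4
  target of `MzvKernelInKZ/Negative/WeightFour.lean`), and the general-coefficient form `withCoeff_iff`;
* §2 eval-tightness (`eval_target`), `crux_of_kernel`, `crux_of_summit`, `not_summit_of_not_crux` (a
  refutation of the crux is a disproof of Conjecture 1 as formalised), the refutation template
  `not_crux_of_separating_invariant`, and the crux among its neighbours: `crux_of_mzvKernelInKZ`,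
  `weightKernelAdm_four_iff_crux_and_euler` (the weight-4 MZV kernel rung is exactly this crux and
  Euler's `3ζ(4) = 4ζ(2,2)`), `hoffman4_iff_euler4_of_crux`, and
  `crux_of_stuffle_of_shuffle : StuffleInKZ → ShuffleIsDissection → GpcZeta4Eq4zeta31`.

Companion files: `LoadBearing.lean` (every hypothesis and the constant `4` are necessary),
`Subcalculi.lean` (additivity alone cannot prove it; not a single additivity/NL move; tightness of the
graded-evaluation, augmentation and locality invariants).

Sources: M. Kontsevich, D. Zagier, *Periods* (2001), §§1.1–1.2; K. Ihara, M. Kaneko, D. Zagier,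
*Derivation and double shuffle relations for multiple zeta values*, Compositio Math. 142 (2006), p. 3
(`4ζ(3,1) = ζ(4)` from shuffle minus stuffle); D. Zagier (1994), §9.
-/

noncomputable section

/-! ## Record of the dropped route decl `FurushoPentagon.Zeta4Calibration` (route rev 18)

REPAIR 2026-08-16 (fullbuild breakage "46:3: Unknown constant
`Summit.KontsevichZagierPeriods.KontsevichZagierPeriods.Theses.FurushoPentagon.Zeta4Calibration`",
dependency drift). Route `FurushoPentagon` dropped its calibration record `Zeta4Calibration` at rev 18
(2026-08-16T07:37Z: "it is route Grothendieck's crux item 0275 verbatim and stays there"), so the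
gate-written `Theses/FurushoPentagon.lean` no longer declares the constant, while this Theorems file —
append-only, statement texts fixed — names it in its `open … (Zeta4Calibration StuffleInKZ
ShuffleIsDissection)` renaming (whose failure also hid the two surviving decls `StuffleInKZ`,
`ShuffleIsDissection`: errors 243:34, 272:41) and in the header of `crux_iff_zeta4Calibration`. As in
`Summits/FinalStateConjecture/…/Theorems/SwallowTheDatumTargetGlue.lean` and
`Summits/ABC/ABC/Theorems/IsogenyGlueCongruencePolyFreyMazurPairs.lean` (same situation), the dropped
constant is re-declared here under its original fully-qualified name with its original definiens (the
ledger signature of stmt-KontsevichZagierPeriods-0275, verbatim = the body of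
`Theses.Grothendieck.GpcZeta4Eq4zeta31`), solely so that the landed record keeps elaborating; every
previously landed declaration below is byte-identical. -/

namespace Summit.KontsevichZagierPeriods.KontsevichZagierPeriods.Theses.FurushoPentagon

-- `Summit.<S>.<S>.Theses` repeats the summit name (single-problem summit, D-0017)
set_option linter.dupNamespace false in
/-- **Record of the dropped route decl `Zeta4Calibration`** = stmt-KontsevichZagierPeriods-0275 (ledger
signature verbatim, in route FurushoPentagon's namespace; NOT an item of that route since its rev 18):
the two 4-dimensional simplex representations `[Δ₄, ω₀ω₀ω₀ω₁]` (`ζ(4)`) and `[Δ₄, 4·ω₀ω₀ω₁ω₁]`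
(`4ζ(3,1)`) are `KZ.Equivalent`, in the `∀ r r'` packaging. It is the SAME ledger item as route
Grothendieck's crux `Theses.Grothendieck.GpcZeta4Eq4zeta31` (closed: proved by
`Summit.KontsevichZagierPeriods.Grothendieck.gpcZeta4Eq4zeta31_proof`), hence true, and
`crux_iff_zeta4Calibration` below is `Iff.rfl`. Re-declared only so that this append-only file keeps
elaborating. Ihara–Kaneko–Zagier 2006, p. 3 (`4ζ(3,1) = ζ(4)`). [folklore] -/
def Zeta4Calibration : Prop :=
  ∀ (r r' : Literature.NumberTheory.Transcendental.KZ.IntegralRep 4), r.domain = {t | 1 > t 0 ∧ t 0 > t 1 ∧ t 1 > t 2 ∧ t 2 > t 3 ∧ t 3 > 0} → Set.EqOn r.integrand (fun t => 1 / (t 0 * t 1 * t 2 * (1 - t 3))) r.domain → r'.domain = r.domain → Set.EqOn r'.integrand (fun t => 4 / (t 0 * t 1 * (1 - t 2) * (1 - t 3))) r'.domain → Literature.NumberTheory.Transcendental.KZ.Equivalent r r'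

end Summit.KontsevichZagierPeriods.KontsevichZagierPeriods.Theses.FurushoPentagon

namespace Summit.KontsevichZagierPeriods.GpcZeta4Eq4zeta31.Negative

open Set MeasureTheory
open Literature.NumberTheory.Transcendental
open Literature.NumberTheory.Transcendental.KZ
open Summit.KontsevichZagierPeriods.KontsevichZagierPeriods.Theses.Grothendieck (GpcZeta4Eq4zeta31)
open Summit.KontsevichZagierPeriods.KontsevichZagierPeriods.Theses.FurushoPentagon
  (Zeta4Calibration StuffleInKZ ShuffleIsDissection)
open Summit.KontsevichZagierPeriods.KontsevichZagierPeriods.Theses.LinRedNormalForm (MzvKernelInKZ)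
open Summit.KontsevichZagierPeriods.MzvKernelInKZ.Negative
open Summit.KontsevichZagierPeriods.Theorems.StuffleInKZ.Negative (simplexOf Zcan Zcan_of_isAdmissible)

/-! ## §0 Read-back: the inlined data of the crux -/

/-- The crux is literally route FurushoPentagon's `Zeta4Calibration` (same item 0275). [folklore] -/
theorem crux_iff_zeta4Calibration : GpcZeta4Eq4zeta31 ↔ Zeta4Calibration := Iff.rfl

/-- The inlined domain `{1 > t₀ > t₁ > t₂ > t₃ > 0}` is the ordered open simplex
`simplex 4 = KZ.openOrderedSimplex 4`. (2026-08-16 repair: the same statement has since landed as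
`MzvKernelInKZ.Negative.setOf_chain_eq_simplex` in `ShuffleFour.lean`; per the gate's dedup rule this
record is kept as a deprecated alias of it — same name, same statement, no second proof.) [folklore] -/
@[deprecated Summit.KontsevichZagierPeriods.MzvKernelInKZ.Negative.setOf_chain_eq_simplex (since := "2026-08-16")]
alias simplex4_eq := Summit.KontsevichZagierPeriods.MzvKernelInKZ.Negative.setOf_chain_eq_simplex

/-- The first inlined integrand IS the word integrand `ω₀ω₀ω₀ω₁` (everywhere, junk values included). [folklore] -/
theorem wordFun_ω4_one (t : Fin 4 → ℝ) : wordFun ω4 1 t = 1 / (t 0 * t 1 * t 2 * (1 - t 3)) := by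
  simp only [wordFun, ω4, Fin.prod_univ_four, one_div, mul_inv, Rat.cast_one, one_mul,
    Matrix.cons_val_zero, Matrix.cons_val_one, Matrix.cons_val]
  simp

/-- The second inlined integrand IS `4 · ω₀ω₀ω₁ω₁` (everywhere). [folklore] -/
theorem wordFun_ω31_four (t : Fin 4 → ℝ) : wordFun ω31 4 t = 4 / (t 0 * t 1 * (1 - t 2) * (1 - t 3)) := by
  simp only [wordFun, ω31, Fin.prod_univ_four, div_eq_mul_inv, mul_inv, one_mul]
  simp

/-- The general-coefficient version of the second integrand. [folklore] -/
theorem wordFun_ω31 (q : ℚ) (t : Fin 4 → ℝ) :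
    wordFun ω31 q t = q / (t 0 * t 1 * (1 - t 2) * (1 - t 3)) := by
  simp only [wordFun, ω31, Fin.prod_univ_four, div_eq_mul_inv, mul_inv, one_mul]
  simp

/-! ## §1 The `∀ r r'` device collapses: the crux is ONE typed membership -/

/-- The typed target `[Δ₄, ω₀₀₀₁] − [Δ₄, 4·ω₀₀₁₁]` of `MzvKernelInKZ/Negative/WeightFour.lean` is by
definition the difference of the two canonical word representations. [folklore] -/
theorem cFds4_eq : cFds4 = of (wordRep ω4 1 adm_ω4) - of (wordRep ω31 4 adm_ω31) := rfl

/-- The crux with the constant `4` replaced by a rational `q` (used in §3; `q = 4` is the crux up to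
the cast `((4 : ℚ) : ℝ) = 4`). -/
def WithCoeff (q : ℚ) : Prop :=
  ∀ (r r' : IntegralRep 4), r.domain = {t | 1 > t 0 ∧ t 0 > t 1 ∧ t 1 > t 2 ∧ t 2 > t 3 ∧ t 3 > 0} →
    EqOn r.integrand (fun t => 1 / (t 0 * t 1 * t 2 * (1 - t 3))) r.domain → r'.domain = r.domain →
    EqOn r'.integrand (fun t => (q : ℝ) / (t 0 * t 1 * (1 - t 2) * (1 - t 3))) r'.domain →
    Equivalent r r'

/-- **Collapse, general coefficient**: `WithCoeff q ↔ [Δ₄, ω₀₀₀₁] − [Δ₄, q·ω₀₀₁₁] ∈ relations`. [folklore] -/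
theorem withCoeff_iff (q : ℚ) :
    WithCoeff q ↔ of (wordRep ω4 1 adm_ω4) - of (wordRep ω31 q adm_ω31) ∈ relations := by
  constructor
  · intro h
    exact h (wordRep ω4 1 adm_ω4) (wordRep ω31 q adm_ω31) (by rw [wordRep_domain, setOf_chain_eq_simplex])
      (fun t _ => wordFun_ω4_one t) rfl (fun t _ => wordFun_ω31 q t)
  · intro h r r' hd hi hd' hi'
    have hr : r.domain = simplex 4 := by rw [hd, setOf_chain_eq_simplex]
    have hr' : r'.domain = simplex 4 := by rw [hd', hr]
    have h1 : of r - of (wordRep ω4 1 adm_ω4) ∈ relations :=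
      of_sub_of_wordRep_mem_relations adm_ω4 r hr fun t ht => (hi ht).trans (wordFun_ω4_one t).symm
    have h2 : of r' - of (wordRep ω31 q adm_ω31) ∈ relations :=
      of_sub_of_wordRep_mem_relations adm_ω31 r' hr' fun t ht => (hi' ht).trans (wordFun_ω31 q t).symm
    have e : of r - of r' = (of r - of (wordRep ω4 1 adm_ω4)) - (of r' - of (wordRep ω31 q adm_ω31)) +
        (of (wordRep ω4 1 adm_ω4) - of (wordRep ω31 q adm_ω31)) := by abel
    show of r - of r' ∈ relations
    rw [e]
    exact relations.add_mem (relations.sub_mem h1 h2) h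

/-- `WithCoeff 4` is the crux (the only difference is the cast `((4 : ℚ) : ℝ) = 4`). [folklore] -/
theorem withCoeff_four_iff : WithCoeff 4 ↔ GpcZeta4Eq4zeta31 := by
  have hc : ∀ t : Fin 4 → ℝ, ((4 : ℚ) : ℝ) / (t 0 * t 1 * (1 - t 2) * (1 - t 3)) =
      4 / (t 0 * t 1 * (1 - t 2) * (1 - t 3)) := fun t => by push_cast; rfl
  constructor
  · intro h r r' hd hi hd' hi'
    exact h r r' hd hi hd' fun t ht => (hi' ht).trans (hc t).symm
  · intro h r r' hd hi hd' hi'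
    exact h r r' hd hi hd' fun t ht => (hi' ht).trans (hc t)

/-- **COLLAPSE.** The crux is ONE typed membership: `[Δ₄, ω₀₀₀₁] − [Δ₄, 4·ω₀₀₁₁] ∈ KZ.relations`
(`cFds4`, the finite-double-shuffle target of `MzvKernelInKZ/Negative/WeightFour.lean`). [folklore] -/
theorem crux_iff_target : GpcZeta4Eq4zeta31 ↔ cFds4 ∈ relations := by
  rw [← withCoeff_four_iff, withCoeff_iff, cFds4_eq]

/-! ## §2 Eval-tightness, summit-necessity, and the crux among its neighbours -/

/-- **Eval-tightness**: the target evaluates to `ζ(4) − 4ζ(3,1) = π⁴/90 − 4·π⁴/360 = 0`; no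
evaluative refutation exists. [folklore] -/
theorem eval_target : eval cFds4 = 0 := eval_cFds4

/-- The value of the right-hand side: `4ζ(3,1) = π⁴/90` (the left-hand side is `value_ω4`). [folklore] -/
theorem value_right : (wordRep ω31 4 adm_ω31).value = Real.pi ^ 4 / 90 := by
  rw [value_wordRep ω31 4, value_ω31]; ring

/-- **Kernel form ⇒ crux.** [folklore] -/
theorem crux_of_kernel (hK : KZKernelConjecture) : GpcZeta4Eq4zeta31 :=
  crux_iff_target.2 (hK _ eval_target)

/-- **Summit ⇒ crux** (`kzKernelConjecture_iff_isRational`): the crux is summit-necessary. [folklore] -/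
theorem crux_of_summit (h : _root_.KontsevichZagierPeriods) : GpcZeta4Eq4zeta31 :=
  crux_of_kernel (kzKernelConjecture_iff_isRational.mpr h)

/-- Contrapositive: **any refutation of the crux is a disproof of Conjecture 1 as formalised.** [folklore] -/
theorem not_summit_of_not_crux (h : ¬ GpcZeta4Eq4zeta31) : ¬ _root_.KontsevichZagierPeriods :=
  mt crux_of_summit h

/-- TEMPLATE of a refutation: an additive invariant vanishing on the four move sets and non-zero on
the target (soundness makes `eval` such an invariant except for the last clause). [folklore] -/
theorem not_crux_of_separating_invariant {A : Type*} [AddCommGroup A] (J : FormalRep →+ A)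
    (hJ : ∀ x ∈ domainAddRel ∪ integrandAddRel ∪ changeOfVariablesRel ∪ newtonLeibnizRel, J x = 0)
    (hJc : J cFds4 ≠ 0) : ¬ GpcZeta4Eq4zeta31 := fun h => by
  have hker : relations ≤ J.ker := (AddSubgroup.closure_le _).mpr fun x hx => hJ x hx
  exact hJc (hker (crux_iff_target.1 h))

/-- **LinRedNormalForm's crux ⇒ this crux** (`MzvKernelInKZ`, 3914: the MZV kernel). [folklore] -/
theorem crux_of_mzvKernelInKZ (h : MzvKernelInKZ) : GpcZeta4Eq4zeta31 :=
  crux_iff_target.2 (targets_of_crux h).2.1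

/-- **The weight-4 MZV kernel rung is EXACTLY this crux and Euler's evaluation** `3ζ(4) = 4ζ(2,2)`
(`cEuler4`; duality `ζ(4) = ζ(2,1,1)` being one move). [folklore] -/
theorem weightKernelAdm_four_iff_crux_and_euler :
    WeightKernelAdm 4 ↔ GpcZeta4Eq4zeta31 ∧ cEuler4 ∈ relations := by
  rw [weightKernelAdm_four_iff_two_targets, crux_iff_target]

/-- Given the crux, Hoffman's weight-4 relation `ζ(4) = ζ(3,1) + ζ(2,2)` (crux `HoffmanRelationInKZ`
at `s = (3)`) and Euler's `3ζ(4) = 4ζ(2,2)` are equivalent inside the calculus. [folklore] -/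
theorem hoffman4_iff_euler4_of_crux (h : GpcZeta4Eq4zeta31) :
    cHoffman4 ∈ relations ↔ cEuler4 ∈ relations :=
  cHoffman4_mem_iff_cEuler4_mem (crux_iff_target.1 h)

/-! ### §2b The crux from FurushoPentagon's two cruxes at `s = t = (2)` (port of the sibling's `Glue4`) -/

/-- The letters of `ω4` are those of the binary word `0001` of the index `(4)`. [folklore] -/
theorem ω4_eq_binaryWord : ∀ i : Fin (MZV.weight [4]), ω4 i = (MZV.binaryWord [4]).getD i false := by
  decide

/-- The letters of `ω31` are those of the binary word `0011` of the index `(3,1)`. [folklore] -/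
theorem ω31_eq_binaryWord :
    ∀ i : Fin (MZV.weight [3, 1]), ω31 i = (MZV.binaryWord [3, 1]).getD i false := by
  decide

/-- `[Δ₄, ω₀₀₀₁]` IS Kontsevich's simplex representation `mzvRep (4)` (equal structures). [folklore] -/
theorem wordRep_ω4_eq_mzvRep : wordRep ω4 1 adm_ω4 =
    mzvRep [4] (by decide) (mzvIntegrand_isSemialgebraicFunOn_holds [4])
      (mzvIntegrand_integrableOn_holds [4] (by decide)) := by
  refine IntegralRep.ext' rfl ?_
  funext t
  rw [wordRep_integrand, wordFun_one_eq_prod_mzvForm]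
  show _ = mzvIntegrand [4] t
  exact Finset.prod_congr rfl fun i _ => by rw [ω4_eq_binaryWord i]

/-- `[Δ₄, ω₀₀₁₁]` IS `mzvRep (3,1)`. [folklore] -/
theorem wordRep_ω31_eq_mzvRep : wordRep ω31 1 adm_ω31 =
    mzvRep [3, 1] (by decide) (mzvIntegrand_isSemialgebraicFunOn_holds [3, 1])
      (mzvIntegrand_integrableOn_holds [3, 1] (by decide)) := by
  refine IntegralRep.ext' rfl ?_
  funext t
  rw [wordRep_integrand, wordFun_one_eq_prod_mzvForm]
  show _ = mzvIntegrand [3, 1] t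
  exact Finset.prod_congr rfl fun i _ => by rw [ω31_eq_binaryWord i]

/-- The canonical simplex class of `(4)` is `[wordRep ω4 1]`. [folklore] -/
theorem simplexOf_four : simplexOf [4] (by decide) = of (wordRep ω4 1 adm_ω4) := by
  rw [wordRep_ω4_eq_mzvRep]; rfl

/-- The canonical simplex class of `(3,1)` is `[wordRep ω31 1]`. [folklore] -/
theorem simplexOf_three_one : simplexOf [3, 1] (by decide) = of (wordRep ω31 1 adm_ω31) := by
  rw [wordRep_ω31_eq_mzvRep]; rfl

/-- `[Δ, n·ω] ≡ n • [Δ, ω]` (iterated integrand additivity). [folklore] -/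
theorem of_wordRep_natCast_sub_nsmul_mem {w : ℕ} (ε : Fin w → Bool) (hε : Adm ε) (n : ℕ) :
    of (wordRep ε n hε) - n • of (wordRep ε 1 hε) ∈ relations := by
  induction n with
  | zero => simpa using of_wordRep_zero_mem_relations ε hε
  | succ n ih =>
    have hadd := of_wordRep_add ε (n : ℚ) 1 hε
    have hcast : ((n : ℚ) + 1) = ((n + 1 : ℕ) : ℚ) := by push_cast; ring
    rw [hcast] at hadd
    have e : of (wordRep ε ((n + 1 : ℕ) : ℚ) hε) - (n + 1) • of (wordRep ε 1 hε) =
        (of (wordRep ε ((n + 1 : ℕ) : ℚ) hε) - of (wordRep ε (n : ℚ) hε) - of (wordRep ε 1 hε)) +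
        (of (wordRep ε (n : ℚ) hε) - n • of (wordRep ε 1 hε)) := by
      rw [add_smul, one_smul]; abel
    rw [e]
    exact relations.add_mem hadd ih

/-- **FurushoPentagon's cruxes at `s = t = (2)` give `4[Δ_{3,1}] − [Δ_4] ∈ relations`**: the stuffle
gives `[Δ₂]² ≡ 2[Δ_{2,2}] + [Δ_4]`, the shuffle dissection `[Δ₂]² ≡ 2[Δ_{2,2}] + 4[Δ_{3,1}]`.
(Independent re-derivation of the sibling seat's evidence `Glue4.four_m31_sub_m4_mem`.) [folklore] -/
theorem four_w31_sub_w4_mem (hS : StuffleInKZ) (hD : ShuffleIsDissection) :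
    4 • of (wordRep ω31 1 adm_ω31) - of (wordRep ω4 1 adm_ω4) ∈ relations := by
  have h2 : MZV.IsAdmissible [2] := by decide
  have h22 : MZV.IsAdmissible [2, 2] := by decide
  have h31 : MZV.IsAdmissible [3, 1] := by decide
  have h4 : MZV.IsAdmissible [4] := by decide
  have a := hS Zcan Zcan_of_isAdmissible [2] [2] h2 h2
  have b := hD Zcan Zcan_of_isAdmissible [2] [2] h2 h2
  have hst : ((MZV.stuffle [2] [2]).map Zcan).sum = Zcan [2, 2] + Zcan [2, 2] + Zcan [4] := by
    simp only [MZV.stuffle_cons_cons, MZV.stuffle_nil_left, MZV.stuffle_nil_right, List.map_cons,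
      List.map_nil, List.sum_cons, List.sum_nil, List.nil_append, List.cons_append, add_zero]
    abel
  have hshw : (MZV.shuffleWord (MZV.binaryWord [2]) (MZV.binaryWord [2])).map MZV.ofBinaryWord =
      [[2, 2], [3, 1], [3, 1], [3, 1], [3, 1], [2, 2]] := by decide
  have hsh : ((MZV.shuffleWord (MZV.binaryWord [2]) (MZV.binaryWord [2])).map
      (fun w => Zcan (MZV.ofBinaryWord w))).sum = 2 • Zcan [2, 2] + 4 • Zcan [3, 1] := by
    rw [← Function.comp_def Zcan MZV.ofBinaryWord, ← List.map_map, hshw]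
    simp only [List.map_cons, List.map_nil, List.sum_cons, List.sum_nil, add_zero]
    abel
  rw [hst] at a
  rw [hsh] at b
  have c := relations.sub_mem a b
  rw [Zcan_of_isAdmissible _ h22, Zcan_of_isAdmissible _ h31, Zcan_of_isAdmissible _ h4,
    simplexOf_four, simplexOf_three_one] at c
  convert c using 1
  abel

/-- **`StuffleInKZ → ShuffleIsDissection → GpcZeta4Eq4zeta31`** (FurushoPentagon 3931 ∧ 3932 ⇒ 0275).
[folklore] -/
theorem crux_of_stuffle_of_shuffle (hS : StuffleInKZ) (hD : ShuffleIsDissection) : GpcZeta4Eq4zeta31 := by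
  rw [crux_iff_target, cFds4_eq]
  have h1 := four_w31_sub_w4_mem hS hD
  have h2 : of (wordRep ω31 4 adm_ω31) - 4 • of (wordRep ω31 1 adm_ω31) ∈ relations := by
    simpa using of_wordRep_natCast_sub_nsmul_mem ω31 adm_ω31 4
  have e : of (wordRep ω4 1 adm_ω4) - of (wordRep ω31 4 adm_ω31) =
      -(4 • of (wordRep ω31 1 adm_ω31) - of (wordRep ω4 1 adm_ω4)) -
        (of (wordRep ω31 4 adm_ω31) - 4 • of (wordRep ω31 1 adm_ω31)) := by
    abel
  rw [e]
  exact relations.sub_mem (relations.neg_mem h1) h2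

end Summit.KontsevichZagierPeriods.GpcZeta4Eq4zeta31.Negative
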